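import Summits.SmoothPoincare4.SmoothPoincare4.Theorems.CylinderEntropyCylinderRungTwoHamiltonMonotonicityDivergence
import HarnessLib

/-!
# Route `CylinderEntropy`, crux `CylinderRungTwo` (stmt-SmoothPoincare4-7631), line `killing-flux`:
# the tilt-excess identity `∫_M (1 - ν₅²) dμ_g = ∫_M H z₅ ν₅ dμ_g`
# (registered helper `helper_tiltExcessIdentity`, the horizontality step)

For a closed immersed cross-section `f : M⁴ → N = S⁴ × ℝ = {z ∈ ℝ⁶ | ∑_{i<5} zᵢ² = 1}` with smooth
unit normal `ν` tangent to `N` and mean curvature `H` (tree `meanCurvature` of `(f, ν)` in `ℝ⁶`), the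
TILT EXCESS satisfies

  `∫_M (1 - ν₅²) dμ_g = ∫_M H · z₅ · ν₅ dμ_g`,   `μ_g` the Riemannian measure of `g = f^*δ`.

This is the first variation of area along the parallel field `X = z₅ e₅`
(`div_M X = |e₅^T|² = 1 - ν₅² - ⟨e₅, n⟩² = 1 - ν₅²`, `n = (z', 0) ⊥ e₅`), equivalently Green's identity
`∫_M Δ_g(φ ∘ f) dμ_g = 0` for the half squared height `φ(z) = z₅² / 2`: we apply the landed ambient
form of that identity (`integral_sliceLaplacian_eq_zero`, part 3 of Hamilton's monotonicity,
`…HamiltonMonotonicityDivergence.lean`) to `φ`, for which `Dφ_p(a) = p₅ a₅` and `D²φ(a, b) = a₅ b₅`, so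
that `Δ_{ℝ⁶} φ = 1`, `D²φ(n, n) = Dφ(n) = 0` (`n₅ = 0`), `D²φ(ν, ν) = ν₅²` and `H Dφ(ν) = H z₅ ν₅`; the
two sides are integrable because `ν`, `z₅ ∘ f` and `H` are continuous on the compact `M`
(`contMDiff_meanCurvature`, `MeanCurvatureRegularity.lean`).

* `hasFDerivAt_halfSqHeight`, `fderiv_halfSqHeight_apply`, `iteratedFDeriv_two_halfSqHeight`,
  `sum_iteratedFDeriv_two_halfSqHeight_single`, `contDiff_halfSqHeight` — the calculus of `φ`;
* `continuous_meanCurvature_euclidean` — `H` is continuous (tree `contMDiff_meanCurvature`);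
* `tiltExcess_eq_integral_meanCurvature_mul` — the identity, with implicit binders;
* `tiltExcess_le_of_abs_height_le` — corollary: `|z₅| ≤ B` on `f(M)` gives
  `∫_M (1 - ν₅²) dμ_g ≤ B ∫_M |H| dμ_g` (`|ν₅| ≤ ‖ν‖ = 1`);
* `integral_abs_le_sqrt_measure_mul_integral_sq` — Cauchy–Schwarz `∫ |h| dμ ≤ √(μ(univ) ∫ h² dμ)` on a
  finite measure space, and `tiltExcess_le_sqrt_of_abs_height_le` — the TILT-EXCESS DECAY
  `∫_M (1 - ν₅²) dμ_g ≤ B √(μ_g(M) ∫_M H² dμ_g)`: almost-stationary cross-sections (`∫ H² → 0`) of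
  bounded area in a slab `|z₅| ≤ B` are asymptotically horizontal;
* `helper_tiltExcessIdentity` — the registered helper, verbatim.

Everything here is PROVED (no `sorry`, no new definitions, no named facts).

References: R. S. Hamilton, Comm. Anal. Geom. 1 (1993) 127–137, §4 (first variation on slices of
`S⁴ × ℝ`); L. Simon, *Lectures on Geometric Measure Theory* (1983), §16 (first variation,
`∫ div_M X = -∫ ⟨H⃗, X⟩`).
-/

-- the prescribed namespace `Summit.SmoothPoincare4.SmoothPoincare4.…` repeats `SmoothPoincare4`
set_option linter.dupNamespace false

noncomputable section

open Bundle Set Function Filter MeasureTheory Module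
open scoped Manifold ContDiff Topology RealInnerProductSpace BigOperators

namespace Summit.SmoothPoincare4.SmoothPoincare4.Cruxes.CylinderRungTwo.KillingFlux

open Literature.Geometry.Riemannian Literature.Geometry.Riemannian.EuclideanHypersurface
open Literature.Geometry.Lorentzian Literature.Geometry.Lorentzian.PseudoRiemannianMetric
open Literature.Geometry.Riemannian.SphericalCylinderEntropy (truncL truncL_apply)
open Literature.Geometry.Manifold.CylinderSlice (padL padL_apply_castSucc padL_apply_last)

/-! ## Calculus of the half squared height `φ(z) = z₅² / 2` on `ℝ⁶` -/

section HalfSqHeight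

/-- The half squared height `φ(z) = z₅² / 2` on `ℝ⁶`, the test function of the tilt-excess
identity (`X = ∇φ = z₅ e₅`), has derivative `Dφ_p = p₅ · e₅^*` (chain rule through the coordinate
functional `e₅^* = EuclideanSpace.proj 5`). [folklore] -/
theorem hasFDerivAt_halfSqHeight (p : EuclideanSpace ℝ (Fin 6)) :
    HasFDerivAt (fun z : EuclideanSpace ℝ (Fin 6) => z 5 ^ 2 / 2)
      ((p 5) • (EuclideanSpace.proj (5 : Fin 6) : EuclideanSpace ℝ (Fin 6) →L[ℝ] ℝ)) p := by
  have h : HasDerivAt (fun t : ℝ => t ^ 2 / 2)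
      ((EuclideanSpace.proj (5 : Fin 6) : EuclideanSpace ℝ (Fin 6) →L[ℝ] ℝ) p)
      ((EuclideanSpace.proj (5 : Fin 6) : EuclideanSpace ℝ (Fin 6) →L[ℝ] ℝ) p) := by
    refine ((hasDerivAt_pow 2 ((EuclideanSpace.proj (5 : Fin 6) :
      EuclideanSpace ℝ (Fin 6) →L[ℝ] ℝ) p)).div_const 2).congr_deriv ?_
    norm_num
  exact h.comp_hasFDerivAt p
    (EuclideanSpace.proj (5 : Fin 6) : EuclideanSpace ℝ (Fin 6) →L[ℝ] ℝ).hasFDerivAt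

/-- `Dφ = (p ↦ p₅ · e₅^*)`, i.e. `fderiv φ = L.smulRight L` for the coordinate functional `L = e₅^*`.
[folklore] -/
theorem fderiv_halfSqHeight :
    fderiv ℝ (fun z : EuclideanSpace ℝ (Fin 6) => z 5 ^ 2 / 2) =
      ⇑((EuclideanSpace.proj (5 : Fin 6) : EuclideanSpace ℝ (Fin 6) →L[ℝ] ℝ).smulRight
        (EuclideanSpace.proj (5 : Fin 6) : EuclideanSpace ℝ (Fin 6) →L[ℝ] ℝ)) := by
  funext p
  rw [(hasFDerivAt_halfSqHeight p).fderiv, ContinuousLinearMap.smulRight_apply]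
  rfl

/-- `Dφ_p(a) = p₅ a₅`. [folklore] -/
theorem fderiv_halfSqHeight_apply (p a : EuclideanSpace ℝ (Fin 6)) :
    fderiv ℝ (fun z : EuclideanSpace ℝ (Fin 6) => z 5 ^ 2 / 2) p a = p 5 * a 5 := by
  rw [(hasFDerivAt_halfSqHeight p).fderiv, smul_apply, smul_eq_mul]
  rfl

/-- `D²φ_p(a, b) = a₅ b₅`. [folklore] -/
theorem iteratedFDeriv_two_halfSqHeight (p a b : EuclideanSpace ℝ (Fin 6)) :
    iteratedFDeriv ℝ 2 (fun z : EuclideanSpace ℝ (Fin 6) => z 5 ^ 2 / 2) p ![a, b] = a 5 * b 5 := by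
  rw [iteratedFDeriv_two_apply, fderiv_halfSqHeight, ContinuousLinearMap.fderiv,
    Matrix.cons_val_zero, Matrix.cons_val_one]
  rw [ContinuousLinearMap.smulRight_apply, smul_apply, smul_eq_mul]
  rfl

/-- `φ(z) = z₅² / 2` is `C²` (indeed a polynomial). [folklore] -/
theorem contDiff_halfSqHeight : ContDiff ℝ 2 (fun z : EuclideanSpace ℝ (Fin 6) => z 5 ^ 2 / 2) :=
  (((EuclideanSpace.proj (5 : Fin 6) : EuclideanSpace ℝ (Fin 6) →L[ℝ] ℝ).contDiff).pow 2).div_const 2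

/-- `Δ_{ℝ⁶} φ = ∑ⱼ D²φ(eⱼ, eⱼ) = 1` (only `j = 5` contributes). [folklore] -/
theorem sum_iteratedFDeriv_two_halfSqHeight_single (p : EuclideanSpace ℝ (Fin 6)) :
    ∑ j : Fin 6, iteratedFDeriv ℝ 2 (fun z : EuclideanSpace ℝ (Fin 6) => z 5 ^ 2 / 2) p
      ![EuclideanSpace.single j (1 : ℝ), EuclideanSpace.single j (1 : ℝ)] = 1 := by
  simp only [iteratedFDeriv_two_halfSqHeight, PiLp.single_apply]
  simp

end HalfSqHeight

/-! ## Cauchy–Schwarz for `∫ |h|` on a finite measure space -/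

section CauchySchwarz

/-- `∫ |h| dμ ≤ √(μ(univ) · ∫ h² dμ)` on a finite measure space, for `h` (a.e. strongly) measurable
with `h²` integrable: Hölder's inequality with exponents `2, 2` for `1 · |h|`
(`integral_mul_le_Lp_mul_Lq_of_nonneg`). [folklore] -/
theorem integral_abs_le_sqrt_measure_mul_integral_sq {X : Type*} [MeasurableSpace X]
    (μ : Measure X) [IsFiniteMeasure μ] {h : X → ℝ} (hh : AEStronglyMeasurable h μ)
    (hint : Integrable (fun x => h x ^ 2) μ) :
    ∫ x, |h x| ∂μ ≤ Real.sqrt ((μ Set.univ).toReal * ∫ x, h x ^ 2 ∂μ) := by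
  have h2 : MemLp h 2 μ := (memLp_two_iff_integrable_sq hh).2 hint
  have h1 : MemLp (fun _ : X => (1 : ℝ)) (ENNReal.ofReal 2) μ := memLp_const 1
  have h2' : MemLp (fun x => |h x|) (ENNReal.ofReal 2) μ := by
    rw [ENNReal.ofReal_ofNat]
    simpa only [Real.norm_eq_abs] using h2.norm
  have hcs := integral_mul_le_Lp_mul_Lq_of_nonneg Real.HolderConjugate.two_two
    (Eventually.of_forall fun _ => zero_le_one) (Eventually.of_forall fun x => abs_nonneg (h x))
    h1 h2'
  have hsq : ∀ x, |h x| ^ (2 : ℝ) = h x ^ 2 := fun x => by rw [Real.rpow_two, sq_abs]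
  simp only [one_mul, Real.one_rpow, integral_const, smul_eq_mul, mul_one, hsq] at hcs
  rw [Real.sqrt_eq_rpow, Real.mul_rpow ENNReal.toReal_nonneg (integral_nonneg fun x => sq_nonneg _)]
  exact hcs

end CauchySchwarz

/-! ## The tilt-excess identity -/

section TiltExcess

variable {M : Type*} [TopologicalSpace M] [ChartedSpace (EuclideanSpace ℝ (Fin 4)) M]
  [IsManifold (𝓡 4) ∞ M] [CompactSpace M] [T2Space M] [MeasurableSpace M] [BorelSpace M]

omit [CompactSpace M] [T2Space M] [MeasurableSpace M] [BorelSpace M] in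
/-- **The mean curvature of a smooth cross-section with smooth unit normal is continuous** (tree
`contMDiff_meanCurvature`, O'Neill 1983, Ch. 4, p. 111 ff., specialised to `f : M⁴ → ℝ⁶`).
[cite: ONeill1983, Ch. 4, p. 111 ff] -/
theorem continuous_meanCurvature_euclidean {f νf : M → EuclideanSpace ℝ (Fin 6)}
    (hf : (euclideanMetric (EuclideanSpace ℝ (Fin 6))).IsSpacelikeImmersion (𝓡 4) f)
    (hν : ContMDiff (𝓡 4) 𝓘(ℝ, EuclideanSpace ℝ (Fin 6)) ∞ νf) :
    Continuous fun w => (euclideanMetric (EuclideanSpace ℝ (Fin 6))).meanCurvature f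
      contMDiff_pullbackBilin_holds hf νf w :=
  ((euclideanMetric (EuclideanSpace ℝ (Fin 6))).contMDiff_meanCurvature
    contMDiff_pullbackBilin_holds hf νf (contMDiff_lift_of_contMDiff hf.contMDiff_self hν)).continuous

/-- **The tilt-excess identity** `∫_M (1 - ν₅²) dμ_g = ∫_M H z₅ ν₅ dμ_g` for a closed immersed
cross-section `f : M⁴ → N = S⁴ × ℝ ⊂ ℝ⁶` with smooth unit normal `ν` tangent to `N`, mean curvature
`H` of `(f, ν)` and `g = f^*δ`: Green's identity `∫_M Δ_g(φ ∘ f) dμ_g = 0` in ambient terms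
(`integral_sliceLaplacian_eq_zero`) for `φ = z₅²/2`, whose integrand is
`(1 - 0 - 0) - (ν₅² - |ν'|²·0) - H z₅ ν₅` (`Dφ_p(a) = p₅a₅`, `D²φ(a,b) = a₅b₅`, `n₅ = 0`); both sides
are integrable (continuous on the compact `M`). Equivalently: the first variation of area along
the parallel field `z₅ e₅`. [cite: Hamilton1993, §4] -/
theorem tiltExcess_eq_integral_meanCurvature_mul {f νf : M → EuclideanSpace ℝ (Fin 6)}
    (hf : (euclideanMetric (EuclideanSpace ℝ (Fin 6))).IsSpacelikeImmersion (𝓡 4) f)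
    (hν : ContMDiff (𝓡 4) 𝓘(ℝ, EuclideanSpace ℝ (Fin 6)) ∞ νf)
    (hun : (euclideanMetric (EuclideanSpace ℝ (Fin 6))).IsUnitNormal (𝓡 4) f νf 1)
    (hN : ∀ x, ∑ i : Fin 5, f x (Fin.castSucc i) ^ 2 = 1)
    (hνN : ∀ x, ∑ i : Fin 5, νf x (Fin.castSucc i) * f x (Fin.castSucc i) = 0) :
    ∫ w, (1 - νf w 5 ^ 2) ∂riemannianMeasure ((euclideanMetric (EuclideanSpace ℝ (Fin 6))).inducedRiemannianMetric f
        contMDiff_pullbackBilin_holds hf) =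
      ∫ w, (euclideanMetric (EuclideanSpace ℝ (Fin 6))).meanCurvature f contMDiff_pullbackBilin_holds
          hf νf w * (f w 5 * νf w 5)
        ∂riemannianMeasure ((euclideanMetric (EuclideanSpace ℝ (Fin 6))).inducedRiemannianMetric f
          contMDiff_pullbackBilin_holds hf) := by
  set g₁ := (euclideanMetric (EuclideanSpace ℝ (Fin 6))).inducedRiemannianMetric f
    contMDiff_pullbackBilin_holds hf with hg₁
  set Hm : M → ℝ := fun w => (euclideanMetric (EuclideanSpace ℝ (Fin 6))).meanCurvature f
    contMDiff_pullbackBilin_holds hf νf w with hHm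
  -- Green's identity for `φ = z₅² / 2`
  have h0 := integral_sliceLaplacian_eq_zero hf hν hun hN hνN contDiff_halfSqHeight
  -- the integrand, pointwise (`H`, `S` stand for the mean curvature and `|ν'|²`)
  have hpt : ∀ (w) (H S : ℝ),
      (((∑ j : Fin 6, iteratedFDeriv ℝ 2 (fun z : EuclideanSpace ℝ (Fin 6) => z 5 ^ 2 / 2) (f w)
              ![EuclideanSpace.single j (1 : ℝ), EuclideanSpace.single j (1 : ℝ)])
            - iteratedFDeriv ℝ 2 (fun z : EuclideanSpace ℝ (Fin 6) => z 5 ^ 2 / 2) (f w)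
                ![padL (truncL (f w)), padL (truncL (f w))]
            - 4 * fderiv ℝ (fun z : EuclideanSpace ℝ (Fin 6) => z 5 ^ 2 / 2) (f w) (padL (truncL (f w))))
          - (iteratedFDeriv ℝ 2 (fun z : EuclideanSpace ℝ (Fin 6) => z 5 ^ 2 / 2) (f w) ![νf w, νf w]
            - S * fderiv ℝ (fun z : EuclideanSpace ℝ (Fin 6) => z 5 ^ 2 / 2) (f w) (padL (truncL (f w))))
          - H * fderiv ℝ (fun z : EuclideanSpace ℝ (Fin 6) => z 5 ^ 2 / 2) (f w) (νf w))
        = (1 - νf w 5 ^ 2) - H * (f w 5 * νf w 5) := by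
    intro w H S
    rw [sum_iteratedFDeriv_two_halfSqHeight_single, iteratedFDeriv_two_halfSqHeight,
      iteratedFDeriv_two_halfSqHeight, fderiv_halfSqHeight_apply, fderiv_halfSqHeight_apply,
      padL_apply_last]
    ring
  have h1 : ∫ w, ((1 - νf w 5 ^ 2) - Hm w * (f w 5 * νf w 5)) ∂riemannianMeasure g₁ = 0 :=
    (integral_congr_ae (Eventually.of_forall fun w => (hpt w _ _).symm)).trans h0
  -- integrability of both sides (continuous functions on the compact `M`)
  have hfc : Continuous f := hf.contMDiff_self.continuous
  have hνc : Continuous νf := hν.continuous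
  have h5 : Continuous fun z : EuclideanSpace ℝ (Fin 6) => z 5 :=
    (EuclideanSpace.proj (5 : Fin 6) : EuclideanSpace ℝ (Fin 6) →L[ℝ] ℝ).continuous
  have hAc : Continuous fun w => 1 - νf w 5 ^ 2 :=
    continuous_const.sub ((h5.comp hνc).pow 2)
  have hBc : Continuous fun w => Hm w * (f w 5 * νf w 5) :=
    (continuous_meanCurvature_euclidean hf hν).mul ((h5.comp hfc).mul (h5.comp hνc))
  have hAi : Integrable (fun w => 1 - νf w 5 ^ 2) (riemannianMeasure g₁) :=
    integrable_of_continuous (h := g₁) hAc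
  have hBi : Integrable (fun w => Hm w * (f w 5 * νf w 5)) (riemannianMeasure g₁) :=
    integrable_of_continuous (h := g₁) hBc
  rw [integral_sub hAi hBi] at h1
  exact sub_eq_zero.1 h1

/-- **Tilt-excess bound from a height bound**: if `|z₅| ≤ B` on `f(M)`, then
`∫_M (1 - ν₅²) dμ_g ≤ B ∫_M |H| dμ_g` (the identity `tiltExcess_eq_integral_meanCurvature_mul` and
`|ν₅| ≤ ‖ν‖ = 1`). [cite: Hamilton1993, §4] -/
theorem tiltExcess_le_of_abs_height_le {f νf : M → EuclideanSpace ℝ (Fin 6)}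
    (hf : (euclideanMetric (EuclideanSpace ℝ (Fin 6))).IsSpacelikeImmersion (𝓡 4) f)
    (hν : ContMDiff (𝓡 4) 𝓘(ℝ, EuclideanSpace ℝ (Fin 6)) ∞ νf)
    (hun : (euclideanMetric (EuclideanSpace ℝ (Fin 6))).IsUnitNormal (𝓡 4) f νf 1)
    (hN : ∀ x, ∑ i : Fin 5, f x (Fin.castSucc i) ^ 2 = 1)
    (hνN : ∀ x, ∑ i : Fin 5, νf x (Fin.castSucc i) * f x (Fin.castSucc i) = 0)
    {B : ℝ} (hB : ∀ x, |f x 5| ≤ B) :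
    ∫ w, (1 - νf w 5 ^ 2) ∂riemannianMeasure ((euclideanMetric (EuclideanSpace ℝ (Fin 6))).inducedRiemannianMetric f
        contMDiff_pullbackBilin_holds hf) ≤
      B * ∫ w, |(euclideanMetric (EuclideanSpace ℝ (Fin 6))).meanCurvature f contMDiff_pullbackBilin_holds
          hf νf w|
        ∂riemannianMeasure ((euclideanMetric (EuclideanSpace ℝ (Fin 6))).inducedRiemannianMetric f
          contMDiff_pullbackBilin_holds hf) := by
  set g₁ := (euclideanMetric (EuclideanSpace ℝ (Fin 6))).inducedRiemannianMetric f
    contMDiff_pullbackBilin_holds hf with hg₁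
  set Hm : M → ℝ := fun w => (euclideanMetric (EuclideanSpace ℝ (Fin 6))).meanCurvature f
    contMDiff_pullbackBilin_holds hf νf w with hHm
  rw [tiltExcess_eq_integral_meanCurvature_mul hf hν hun hN hνN, ← integral_const_mul]
  have hνunit : ∀ w, ‖νf w‖ = 1 := fun w => by
    have h : ⟪νf w, νf w⟫ = (1 : ℝ) := by
      have := hun.val_self w
      rwa [euclideanMetric_apply] at this
    rw [real_inner_self_eq_norm_sq] at h
    nlinarith [norm_nonneg (νf w)]
  have hν5 : ∀ w, |νf w 5| ≤ 1 := fun w => by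
    have h1 : |νf w 5| = ‖νf w 5‖ := (Real.norm_eq_abs _).symm
    rw [h1, ← hνunit w]
    exact PiLp.norm_apply_le (νf w) 5
  have hHc : Continuous Hm := continuous_meanCurvature_euclidean hf hν
  have hBi : Integrable (fun w => B * |Hm w|) (riemannianMeasure g₁) :=
    integrable_of_continuous (h := g₁) (continuous_const.mul hHc.abs)
  have hfc : Continuous f := hf.contMDiff_self.continuous
  have hνc : Continuous νf := hν.continuous
  have h5 : Continuous fun z : EuclideanSpace ℝ (Fin 6) => z 5 :=
    (EuclideanSpace.proj (5 : Fin 6) : EuclideanSpace ℝ (Fin 6) →L[ℝ] ℝ).continuous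
  have hLi : Integrable (fun w => Hm w * (f w 5 * νf w 5)) (riemannianMeasure g₁) :=
    integrable_of_continuous (h := g₁) (hHc.mul ((h5.comp hfc).mul (h5.comp hνc)))
  refine integral_mono hLi hBi fun w => ?_
  have h1 : |f w 5 * νf w 5| ≤ B := by
    rw [abs_mul]
    calc |f w 5| * |νf w 5| ≤ B * 1 :=
          mul_le_mul (hB w) (hν5 w) (abs_nonneg _) ((abs_nonneg _).trans (hB w))
      _ = B := mul_one B
  calc Hm w * (f w 5 * νf w 5) ≤ |Hm w * (f w 5 * νf w 5)| := le_abs_self _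
    _ = |Hm w| * |f w 5 * νf w 5| := abs_mul _ _
    _ ≤ |Hm w| * B := mul_le_mul_of_nonneg_left h1 (abs_nonneg _)
    _ = B * |Hm w| := mul_comm _ _

/-- **Tilt-excess decay**: if `|z₅| ≤ B` on `f(M)`, then
`∫_M (1 - ν₅²) dμ_g ≤ B √(μ_g(M) ∫_M H² dμ_g)` (`tiltExcess_le_of_abs_height_le` and Cauchy–Schwarz,
`integral_abs_le_sqrt_measure_mul_integral_sq`): almost-stationary (`∫ H² → 0`) cross-sections of
bounded area in a slab are asymptotically horizontal. [cite: Hamilton1993, §4] -/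
theorem tiltExcess_le_sqrt_of_abs_height_le {f νf : M → EuclideanSpace ℝ (Fin 6)}
    (hf : (euclideanMetric (EuclideanSpace ℝ (Fin 6))).IsSpacelikeImmersion (𝓡 4) f)
    (hν : ContMDiff (𝓡 4) 𝓘(ℝ, EuclideanSpace ℝ (Fin 6)) ∞ νf)
    (hun : (euclideanMetric (EuclideanSpace ℝ (Fin 6))).IsUnitNormal (𝓡 4) f νf 1)
    (hN : ∀ x, ∑ i : Fin 5, f x (Fin.castSucc i) ^ 2 = 1)
    (hνN : ∀ x, ∑ i : Fin 5, νf x (Fin.castSucc i) * f x (Fin.castSucc i) = 0)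
    {B : ℝ} (hB : ∀ x, |f x 5| ≤ B) :
    ∫ w, (1 - νf w 5 ^ 2) ∂riemannianMeasure ((euclideanMetric (EuclideanSpace ℝ (Fin 6))).inducedRiemannianMetric f
        contMDiff_pullbackBilin_holds hf) ≤
      B * Real.sqrt ((riemannianMeasure ((euclideanMetric (EuclideanSpace ℝ (Fin 6))).inducedRiemannianMetric f
          contMDiff_pullbackBilin_holds hf) Set.univ).toReal *
        ∫ w, (euclideanMetric (EuclideanSpace ℝ (Fin 6))).meanCurvature f contMDiff_pullbackBilin_holds
          hf νf w ^ 2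
        ∂riemannianMeasure ((euclideanMetric (EuclideanSpace ℝ (Fin 6))).inducedRiemannianMetric f
          contMDiff_pullbackBilin_holds hf)) := by
  set g₁ := (euclideanMetric (EuclideanSpace ℝ (Fin 6))).inducedRiemannianMetric f
    contMDiff_pullbackBilin_holds hf with hg₁
  set Hm : M → ℝ := fun w => (euclideanMetric (EuclideanSpace ℝ (Fin 6))).meanCurvature f
    contMDiff_pullbackBilin_holds hf νf w with hHm
  haveI : IsFiniteMeasure (riemannianMeasure g₁) := isFiniteMeasure_riemannianMeasure g₁
  have hHc : Continuous Hm := continuous_meanCurvature_euclidean hf hν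
  refine (tiltExcess_le_of_abs_height_le hf hν hun hN hνN hB).trans ?_
  rcases isEmpty_or_nonempty M with hM | hM
  · -- `M = ∅`: every integral vanishes
    have h0 : ∀ (μ' : Measure M) (F : M → ℝ), ∫ w, F w ∂μ' = 0 := fun μ' F => by
      rw [Measure.eq_zero_of_isEmpty μ', integral_zero_measure]
    simp [h0]
  · have hB0 : 0 ≤ B := (abs_nonneg _).trans (hB (Classical.arbitrary M))
    exact mul_le_mul_of_nonneg_left (integral_abs_le_sqrt_measure_mul_integral_sq _
      hHc.aestronglyMeasurable (integrable_of_continuous (h := g₁) (hHc.pow 2))) hB0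

end TiltExcess

/-- **Registered helper `helper_tiltExcessIdentity` of line `killing-flux` (the horizontality step,
first variation of area along `z₅ e₅`).** For a closed immersed cross-section `f : M⁴ → N = S⁴ × ℝ`
with smooth unit normal `ν` tangent to `N` and mean curvature `H` of `(f, ν)`:
`∫_M (1 - ν₅²) dμ_g = ∫_M H z₅ ν₅ dμ_g`, `μ_g` the Riemannian measure of `g = f^*δ`
(`tiltExcess_eq_integral_meanCurvature_mul`). [cite: Hamilton1993, §4] -/
theorem helper_tiltExcessIdentity :
    ∀ (M : Type) [TopologicalSpace M] [ChartedSpace (EuclideanSpace ℝ (Fin 4)) M] [IsManifold (𝓡 4) ∞ M] [CompactSpace M] [T2Space M] [MeasurableSpace M] [BorelSpace M] (f νf : M → EuclideanSpace ℝ (Fin 6)) (hf : (Literature.Geometry.Riemannian.euclideanMetric (EuclideanSpace ℝ (Fin 6))).IsSpacelikeImmersion (𝓡 4) f), ContMDiff (𝓡 4) (𝓡 6) ∞ νf → (Literature.Geometry.Riemannian.euclideanMetric (EuclideanSpace ℝ (Fin 6))).IsUnitNormal (𝓡 4) f νf 1 → (∀ x, ∑ i : Fin 5, f x (Fin.castSucc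 i) ^ 2 = 1) → (∀ x, ∑ i : Fin 5, νf x (Fin.castSucc i) * f x (Fin.castSucc i) = 0) → ∫ w, (1 - νf w 5 ^ 2) ∂Literature.Geometry.Lorentzian.riemannianMeasure ((Literature.Geometry.Riemannian.euclideanMetric (EuclideanSpace ℝ (Fin 6))).inducedRiemannianMetric f Literature.Geometry.Lorentzian.PseudoRiemannianMetric.contMDiff_pullbackBilin_holds hf) = ∫ w, (Literature.Geometry.Riemannian.euclideanMetric (EuclideanSpace ℝ (Fin 6))).meanCurvature f Literature.Geometry.Lorentzian.PseudoRiemannianMetric.contMDiff_pullbackBilin_holds hf νf w * (f w 5 * νf w 5) ∂Literature.Geometry.Lorentzian.riemannianMeasure ((Literature.Geometry.Riemannian.euclideanMetric (EuclideanSpace ℝ (Fin 6))).inducedRiemannianMetric f Literature.Geometry.Lorentzian.PseudoRiemannianMetric.contMDiff_pullbackBilin_holds hf) :=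
  fun _ _ _ _ _ _ _ _ _ _ hf hν hun hN hνN =>
    tiltExcess_eq_integral_meanCurvature_mul hf hν hun hN hνN

end Summit.SmoothPoincare4.SmoothPoincare4.Cruxes.CylinderRungTwo.KillingFlux

end
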